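import Literature.AlgebraicGeometry.Resolution.BadCurveStep
import Literature.AlgebraicGeometry.Resolution.ZariskiPatchingGlue
import HarnessLib

/-!
# Zariski's bad-curve induction and the patching theorem from principalization

Topic: `Literature/AlgebraicGeometry/Resolution`. We complete Zariski's Patching Theorem for the
property `P = P_reg` of projective models of a function field `K/k` of transcendence degree three
(Zariski–Samuel II, Ch. VI §17, "Fundamental theorem" p. 539; Piltant 2013, Prop. 5.1 with Cor. 5.7;
Cossart–Piltant 2019, proof of Prop. 4.6) MODULO ONLY Cossart–Piltant's principalization theorem
for arithmetical threefolds (`CossartPiltant2019Principalization`, their Prop. 4.4):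

* `ProjModel.exists_regLe_pair_over` — for `η : B → A` and an open `U ⊆ Reg A` there is a
  projective model `Y` dominating `A` and `B` with `ψ_A⁻¹(U) ⊆ Reg Y` and `ψ_B⁻¹(Reg B) ⊆ Reg Y`:
  strong induction on the measure `badMeasure A U B` (the number of iterated quadratic transforms
  without centre on `B` of the local rings of the bad points; Piltant's `N_η`), the step being
  `ProjModel.exists_step` (`BadCurveStep.lean`: principalize the ideal of a bad curve, replace `B`
  by the join with the Step-2 model) and the base case (no bad point) Piltant's Step 5
  (`exists_regLe_pair_of_closure_subset`, `PatchingStepFive.lean`). This replaces Piltant's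
  factorizability Lemma 5.3 (which needs resolution of surfaces over non-closed fields) by
  Abhyankar's factorization theorem and the base-tree count (Zariski–Samuel II, App. 5).
* `ProjModel.twoModelPatching_of_principalization` — Piltant's Prop. 5.1 for `P = P_reg`: any two
  projective models are dominated by one with both preimages of the regular loci regular
  (Step 2, `exists_hom_regLe_of_principalization_of_trdeg`, then the induction over `Reg M₁`).
* `CossartPiltant2019Patching.of_principalization` — **the patching half of Cossart–Piltant's
  Theorem 1.1 follows from their principalization Prop. 4.4**
  (`CossartPiltant2019Patching.of_twoModelPatching`, `ZariskiPatchingGlue.lean`).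

All PROVED; the named fact `CossartPiltant2019Principalization` enters as a hypothesis only.

## References

* O. Zariski, P. Samuel, *Commutative Algebra* II (1960), Ch. VI §17. [ZariskiSamuel1960]
* O. Piltant, RACSAM 107 (2013) 91–121, Prop. 5.1, Lemma 5.6, Cor. 5.7. [Piltant2013]
* V. Cossart, O. Piltant, J. Algebra 529 (2019) 268–535, Thm. 1.1, Prop. 4.4, Prop. 4.6.
  [CossartPiltant2019]
-/

noncomputable section

open CategoryTheory CategoryTheory.Limits AlgebraicGeometry TopologicalSpace IsLocalRing Order
open Literature.AlgebraicGeometry.Motives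

universe u

namespace Literature.AlgebraicGeometry.Resolution

namespace ProjModel

variable {k K : Type u} [Field k] [Field K] [Algebra k K]

/-- The generic point of a model lies over the generic point. [folklore] -/
theorem Hom.f_genericPoint {N M : ProjModel k K} (φ : N.Hom M) :
    φ.f (genericPoint N.X) = genericPoint M.X :=
  RatFn.genericPoint_eq_of_isDominant φ.f

/-- **Zariski's bad-curve induction** (Piltant 2013, proof of Prop. 5.1, Steps 3–5, for
`P = P_reg`, the factorizability Lemma 5.3 replaced by the base-tree count): for a morphism of
projective models `η : B → A` of a function field of transcendence degree three and a non-empty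
open `U ⊆ Reg A`, assuming Cossart–Piltant's principalization, there is a projective model `Y`
with morphisms `ψ_A : Y → A`, `ψ_B : Y → B` such that `ψ_A⁻¹(U) ⊆ Reg Y` and
`ψ_B⁻¹(Reg B) ⊆ Reg Y`. [cite: Piltant2013, Prop. 5.1 (proof, Steps 3–5), Lemma 5.6] -/
theorem exists_regLe_pair_over (hP : CossartPiltant2019Principalization.{u})
    (htr : Algebra.trdeg k K = 3) :
    ∀ (n : ℕ) (A B : ProjModel k K) (_ : B.Hom A) (U : A.X.Opens),
      (U : Set A.X) ⊆ Scheme.regularLocus A.X → (U : Set A.X).Nonempty → badMeasure A U B = n →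
      ∃ (Y : ProjModel k K) (ψA : Y.Hom A) (ψB : Y.Hom B),
        (∀ y : Y.X, ψA.f y ∈ U → IsRegularLocalRing (Y.X.presheaf.stalk y)) ∧ ψB.RegLe := by
  intro n
  induction n using Nat.strong_induction_on with
  | _ n ih =>
  intro A B η U hU hUne hn
  by_cases hbad : ∃ x, IsBad A B U x
  · -- a bad point: one step, then the induction hypothesis
    obtain ⟨x, hx⟩ := hbad
    obtain ⟨A', B', ρ, η', θ, hθ, hregU', hlt⟩ := exists_step hP htr η hU hx
    have hU' : ((ρ.f ⁻¹ᵁ U : A'.X.Opens) : Set A'.X) ⊆ Scheme.regularLocus A'.X :=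
      preimage_subset_regularLocus ρ hregU'
    have hU'ne : ((ρ.f ⁻¹ᵁ U : A'.X.Opens) : Set A'.X).Nonempty := by
      refine ⟨genericPoint A'.X, ?_⟩
      show ρ.f (genericPoint A'.X) ∈ U
      rw [ρ.f_genericPoint]
      exact A.genericPoint_mem hUne
    obtain ⟨Y, ψA', ψB', hA', hB'⟩ :=
      ih _ (hn ▸ hlt) A' B' η' (ρ.f ⁻¹ᵁ U) hU' hU'ne rfl
    refine ⟨Y, ψA'.comp ρ, ψB'.comp θ, fun y hy => hA' y hy, hB'.comp hθ⟩
  · -- no bad point: Step 5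
    push Not at hbad
    have hdimA : topologicalKrullDim A.X = 3 := by rw [A.topologicalKrullDim_eq_of_trdeg htr]; rfl
    exact exists_regLe_pair_of_closure_subset A B η U hU hUne
      (principalization_opens_of_principalization hP A hdimA U hU hUne)
      (closure_inter_subset_of_forall_not_isBad hbad)

/-- **Piltant's Prop. 5.1 for `P = P_reg` from Cossart–Piltant's principalization**: two
projective models of a function field of transcendence degree three over any field are dominated
by a projective model on which the preimages of both regular loci are regular (Step 2, then the
bad-curve induction over `Reg M₁`). [cite: Piltant2013, Prop. 5.1; CossartPiltant2019, Prop. 4.6 (proof, Step 3)] -/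
theorem twoModelPatching_of_principalization (hP : CossartPiltant2019Principalization.{u})
    (htr : Algebra.trdeg k K = 3) (M₁ M₂ : ProjModel k K) :
    ∃ (N : ProjModel k K) (φ₁ : N.Hom M₁) (φ₂ : N.Hom M₂), φ₁.RegLe ∧ φ₂.RegLe := by
  -- Step 2: `N₀ → M₁`, `N₀ → M₂` with `Reg M₂` regular preimage
  obtain ⟨N₀, η, φ₂, hφ₂⟩ := exists_hom_regLe_of_principalization_of_trdeg hP htr M₁ M₂
  -- the regular locus of `M₁` as an open
  have hqe : Scheme.IsQuasiExcellent M₁.X :=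
    (Scheme.isExcellent_of_locallyOfFiniteType Stacks07QW_field_holds M₁.π).isQuasiExcellent
  obtain ⟨U, hU⟩ := Scheme.exists_opens_coe_eq_regularLocus hqe
  have hUne : (U : Set M₁.X).Nonempty := by
    rw [hU]; exact (Scheme.dense_regularLocus M₁.X).nonempty
  obtain ⟨Y, ψA, ψB, hA, hB⟩ := exists_regLe_pair_over hP htr _ M₁ N₀ η U hU.le hUne rfl
  refine ⟨Y, ψA, ψB.comp φ₂, fun y hy => hA y ?_, hB.comp hφ₂⟩
  show ψA.f y ∈ (U : Set M₁.X)
  rw [hU]; exact hy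

end ProjModel

/-- **Cossart–Piltant's patching from their principalization theorem.** The patching half of
Cossart–Piltant 2019, Thm. 1.1 (`CossartPiltant2019Patching`: resolution in dimension `≤ 2` and
local uniformization in dimension three give resolution of projective threefolds over any field)
follows from their principalization Prop. 4.4 (`CossartPiltant2019Principalization`) by
Zariski's Patching Theorem for `P = P_reg` — Zariski's compactness of the Riemann space and
Piltant's Prop. 5.1, the latter proved here by the bad-curve induction
(`ProjModel.twoModelPatching_of_principalization`) instead of Piltant's Lemma 5.3.
[cite: CossartPiltant2019, Thm. 1.1 and Prop. 4.6 (proof); Piltant2013, Prop. 5.1, Cor. 5.7] -/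
theorem CossartPiltant2019Patching.of_principalization
    (hP : CossartPiltant2019Principalization.{u}) : CossartPiltant2019Patching.{u} :=
  CossartPiltant2019Patching.of_twoModelPatching' fun _ _ _ _ _ _ htr M₁ M₂ =>
    ProjModel.twoModelPatching_of_principalization hP htr M₁ M₂

end Literature.AlgebraicGeometry.Resolution

end
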